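import Literature.MathematicalPhysics.QuantumFieldTheory.Balaban1983to89.Beta.GaugeFixingPropagators
import Literature.MathematicalPhysics.QuantumFieldTheory.Balaban1983to89.Beta.GaugeFixing

/-!
# `BalabanUV.Beta.FP.SlicedTraceParity` — road «FP» for binder row D1, ROUTE T, the (TN) rows of W-FP-19-18 ∕ an2 Q-an2-g39-1:
# **A PARITY-ODD, BI-TRANSVERSAL REMAINDER IS TRACE-NULL AGAINST EVERY SLICED PROPAGATOR** — the gauge slice may break the reflection symmetry,
# the trace does not see it

WHY.  The road's laws are AFFINE in the second-order jets (`KktPolarisation` §4): the dictionary may feed representative second-order tables at the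
price of ONE trace-null row per system, `tr(F_P · R) = 0` with `F_P = flucCov H P` the propagator of the form `H` on the gauge slice `P` (`P·W`
invertible, `W` the gauge modes, `H·W = 0`).  an2's located fact (W-an2-g39-4): the only second-order table with a remainder is the MIXED one and its
remainder is PARITY-ODD under an axis reflection; his `tadpole_eq_zero_of_parity` discharges traces against the UNSLICED covariant resolvent; the comb
slice `P` is NOT reflection-invariant.  THIS FILE ([folklore], over Literature `GaugeFixingPropagators` §2b): if the form `H` is reflection-COVARIANT (`H∘(e,e) = H` for a relabelling `e`
of the fields; `g` relabels the slice rows), the remainder `R` is ODD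
(`R∘(e,e) = −R`) and BI-TRANSVERSAL (`R·W = 0`, `Wᵀ·R = 0`), and both `P` and its reflection `P∘(g,e)` are admissible slices, then `tr(flucCov H P · R) = 0`
— FOR THAT (non-invariant) SLICE.  Proof: relabelling gives `tr(F_P R) = −tr(F_{Pσ} R)`; SLICE INDEPENDENCE for bi-transversal insertions
(`flucCov_sliceChange`: `F_{Pσ} = Π F_P Πᵀ`, `Π = 1 − W(PσW)⁻¹Pσ`, and `Πᵀ R Π = R`) gives `tr(F_{Pσ} R) = tr(F_P R)`; hence `tr(F_P R) = 0`.  §1 relabelling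
bookkeeping; §2 slice independence of the trace; §3 the theorem; §4 the THREE-BLOCK form (constraint `[Q; τ]`, averaging `Q` reflection-covariant and
killing the gauge modes) — the shape of the road's fine sliced systems `kkt H₀ [Q₁₀; τ₁]`.  No `def`, no `def … : Prop`, nothing cited beyond the Literature module's own [folklore]
tags, 0 sorry.  Nothing of the dictionary asserted: WHICH remainder is odd and bi-transversal is an2's ∕ leaf-02's line.

HONEST DEPENDENCY (page 1, mandatory): continuum YM on T⁴ ⇐ BetaPertH ∧ nine spine estimates (0/9 proved); BetaPertH ⇐ (D1) ∧ (D4) ∧ CAP+tail;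
G-an2-4 gates asym, D1 and NE2/3/4.  HONEST FRAMING (cell contract, verbatim): «discharging `BetaPertH` makes Bałaban's UV stability UNCONDITIONAL —
a real constructive-QFT result; it is NOT the continuum limit and NOT the Clay problem.»  ABSOLUTE RULE (cell charter, verbatim): «No internally-minted
statement may enter as a cited fact. Every hypothesis is either kernel-proved in this package or a verbatim quotation of a PUBLISHED theorem with page
reference. The manuscript(s) under audit are NOT citable for their own disputed steps — they are the thing under adjudication; programme-internal
(2001/route/tribunal) claims are never citable.»  0 estimates; 0∕4 row-D1 binders; NOT (T-ID), NOT SDF, NOT D1, NOT BetaPertH, NOT continuum, NOT Clay.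
Road «FP» OWNER, b2b-balaban-beta-d1-p3 gen 19, 2026-08-22.  No existing file touched.
-/

noncomputable section

namespace Summit.QuantumFields.BalabanUV.Beta.FP.SlicedTraceParity

open Matrix
open Literature.MathematicalPhysics.QuantumFieldTheory.Balaban1983to89.Beta.Composition (kkt)
open Literature.MathematicalPhysics.QuantumFieldTheory.Balaban1983to89.Beta.CompositionSingular (flucCov)
open Literature.MathematicalPhysics.QuantumFieldTheory.Balaban1983to89.Beta.GaugeFixingPropagators (flucCov_sliceChange mul_gaugeProj
  transpose_gaugeProj_mul_of_invariant)
open Literature.MathematicalPhysics.QuantumFieldTheory.Balaban1983to89.Beta.GaugeFixing (reindex_kkt_kkt kkt_mul_fromRows kkt_transpose_mul_fromRows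
  fromCols_zero_mul_fromRows_zero)

variable {α ρ : Type*} [Fintype α] [Fintype ρ] [DecidableEq α] [DecidableEq ρ]

/-! ## §1 Relabelling bookkeeping -/

omit [Fintype α] [Fintype ρ] [DecidableEq α] [DecidableEq ρ] in
/-- [folklore] the doubly bordered matrix of relabelled data is the relabelled doubly bordered matrix. -/
theorem kkt_submatrix (H : Matrix α α ℝ) (P : Matrix ρ α ℝ) (e : α ≃ α) (g : ρ ≃ ρ) :
    kkt (H.submatrix e e) (P.submatrix g e) = (kkt H P).submatrix (e.sumCongr g) (e.sumCongr g) := by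
  ext (i | i) (j | j) <;> rfl

omit [Fintype α] [Fintype ρ] [DecidableEq α] [DecidableEq ρ] in
/-- [folklore] the `(1,1)` block of a `sumCongr`-relabelled matrix. -/
theorem toBlocks₁₁_submatrix_sumCongr (X : Matrix (α ⊕ ρ) (α ⊕ ρ) ℝ) (e : α ≃ α) (g : ρ ≃ ρ) :
    (X.submatrix (e.sumCongr g) (e.sumCongr g)).toBlocks₁₁ = X.toBlocks₁₁.submatrix e e := by
  ext i j; rfl

/-- [folklore] **THE PROPAGATOR OF RELABELLED DATA IS THE RELABELLED PROPAGATOR**: `flucCov (H∘(e,e)) (P∘(g,e)) = (flucCov H P)∘(e,e)`. -/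
theorem flucCov_submatrix (H : Matrix α α ℝ) (P : Matrix ρ α ℝ) (e : α ≃ α) (g : ρ ≃ ρ) :
    flucCov (H.submatrix e e) (P.submatrix g e) = (flucCov H P).submatrix e e := by
  unfold flucCov
  rw [kkt_submatrix, Matrix.inv_submatrix_equiv, toBlocks₁₁_submatrix_sumCongr]

omit [Fintype ρ] [DecidableEq α] [DecidableEq ρ] in
/-- [folklore] the trace is invariant under a simultaneous relabelling. -/
theorem trace_submatrix_equiv (M : Matrix α α ℝ) (e : α ≃ α) : (M.submatrix e e).trace = M.trace := by
  simp only [Matrix.trace, Matrix.diag, Matrix.submatrix_apply]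
  exact e.sum_comp (fun i => M i i)

/-! ## §2 Slice independence of the trace against a bi-transversal insertion -/

/-- [folklore] **`tr(F_P · R)` DOES NOT DEPEND ON THE SLICE when `R` is bi-transversal** (`R·W = 0`, `Wᵀ·R = 0`): for two admissible slices `τ P` of the
gauge modes `W` of a form `H` (`H·W = Hᵀ·W = 0`), `tr(flucCov H P · R) = tr(flucCov H τ · R)` — `flucCov_sliceChange` (`F_P = Π F_τ Πᵀ`) and `Πᵀ R Π = R`. -/
theorem trace_flucCov_mul_sliceChange (H : Matrix α α ℝ) (τ P : Matrix ρ α ℝ) (W : Matrix α ρ ℝ) (R : Matrix α α ℝ)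
    (hHW : H * W = 0) (hHtW : Hᵀ * W = 0) (hT : IsUnit (τ * W).det) (hS : IsUnit (P * W).det) (h : IsUnit (kkt H τ).det)
    (hRW : R * W = 0) (hWR : Wᵀ * R = 0) :
    (flucCov H P * R).trace = (flucCov H τ * R).trace := by
  rw [flucCov_sliceChange H τ P W hHW hHtW hT hS h, Matrix.mul_assoc, Matrix.mul_assoc, Matrix.trace_mul_comm, Matrix.mul_assoc,
    transpose_gaugeProj_mul_of_invariant P W R hWR, mul_gaugeProj R P W hRW, Matrix.trace_mul_comm]

/-! ## §3 Parity-odd bi-transversal remainders are trace-null against every sliced propagator -/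

/-- [folklore] **(TN) FOR A NON-INVARIANT SLICE.**  Form `H` reflection-COVARIANT (`H∘(e,e) = H`; the gauge modes `W` need NOT be relabelled — only the two
slices' admissibility for the same `W` enters), remainder `R` PARITY-ODD (`R∘(e,e) = −R`) and BI-TRANSVERSAL (`R·W = 0`, `Wᵀ·R = 0`), the slice `P` and its reflection `P∘(g,e)` both admissible (`P·W`, `(P∘(g,e))·W`
and `kkt H P` invertible), `H·W = Hᵀ·W = 0`: then `tr(flucCov H P · R) = 0`. -/
theorem trace_flucCov_mul_eq_zero_of_odd (H : Matrix α α ℝ) (P : Matrix ρ α ℝ) (W : Matrix α ρ ℝ) (R : Matrix α α ℝ) (e : α ≃ α) (g : ρ ≃ ρ)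
    (hH : H.submatrix e e = H) (hR : R.submatrix e e = -R)
    (hHW : H * W = 0) (hHtW : Hᵀ * W = 0) (hS : IsUnit (P * W).det) (hSσ : IsUnit (P.submatrix g e * W).det) (h : IsUnit (kkt H P).det)
    (hRW : R * W = 0) (hWR : Wᵀ * R = 0) :
    (flucCov H P * R).trace = 0 := by
  -- relabelling: `tr(F_P R) = tr((F_P R)∘(e,e)) = tr(F_{Pσ} · R∘(e,e)) = −tr(F_{Pσ} R)`
  have e1 : (flucCov H P * R).trace = -(flucCov H (P.submatrix g e) * R).trace := by
    have hF : flucCov H (P.submatrix g e) = (flucCov H P).submatrix e e := by rw [← flucCov_submatrix H P e g, hH]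
    rw [← trace_submatrix_equiv (flucCov H P * R) e, ← Matrix.submatrix_mul_equiv (flucCov H P) R e e e, ← hF, hR, Matrix.mul_neg,
      Matrix.trace_neg]
  -- slice independence: `tr(F_{Pσ} R) = tr(F_P R)`
  have e2 : (flucCov H (P.submatrix g e) * R).trace = (flucCov H P * R).trace :=
    trace_flucCov_mul_sliceChange H P (P.submatrix g e) W R hHW hHtW hS hSσ h hRW hWR
  linarith

/-! ## §4 Three blocks: averaging constraint `Q` + slice `τ` — the road's fine sliced systems -/

section ThreeBlock

variable {ν μ : Type*} [Fintype ν] [Fintype μ] [DecidableEq ν] [DecidableEq μ]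

omit [Fintype α] [Fintype ρ] [DecidableEq α] [DecidableEq ρ] [Fintype ν] [Fintype μ] [DecidableEq ν] [DecidableEq μ] in
/-- [folklore] the `(1,1)` block of the `sumAssoc`-reindexed matrix is the `(1,1)` block of the `(1,1)` block. -/
theorem toBlocks₁₁_reindex_sumAssoc (X : Matrix ((ν ⊕ μ) ⊕ ρ) ((ν ⊕ μ) ⊕ ρ) ℝ) :
    (Matrix.reindex (Equiv.sumAssoc ν μ ρ) (Equiv.sumAssoc ν μ ρ) X).toBlocks₁₁ = X.toBlocks₁₁.toBlocks₁₁ := by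
  ext i j; rfl

/-- [folklore] **THREE BLOCKS → TWO**: the propagator of `K` under the stacked constraint `[Q; τ]` is the field block of the propagator of the bordered form
`kkt K Q` under the padded slice `[τ | 0]` (`GaugeFixing.reindex_kkt_kkt`). -/
theorem flucCov_fromRows_eq (K : Matrix ν ν ℝ) (Q : Matrix μ ν ℝ) (τ : Matrix ρ ν ℝ) :
    flucCov K (fromRows Q τ) = (flucCov (kkt K Q) (fromCols τ (0 : Matrix ρ μ ℝ))).toBlocks₁₁ := by
  unfold flucCov
  rw [← reindex_kkt_kkt, Matrix.inv_reindex, toBlocks₁₁_reindex_sumAssoc]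

omit [Fintype α] [Fintype ρ] [DecidableEq α] [DecidableEq ρ] [DecidableEq ν] [DecidableEq μ] in
/-- [folklore] a corner insertion sees only the corner block of the operator: `tr(X · [[R,0],[0,0]]) = tr(X₁₁ · R)`. -/
theorem trace_mul_fromBlocks_corner (X : Matrix (ν ⊕ μ) (ν ⊕ μ) ℝ) (R : Matrix ν ν ℝ) :
    (X * fromBlocks R 0 0 (0 : Matrix μ μ ℝ)).trace = (X.toBlocks₁₁ * R).trace := by
  simp only [Matrix.trace, Matrix.diag, Matrix.mul_apply, Fintype.sum_sum_type, Matrix.fromBlocks_apply₁₁, Matrix.fromBlocks_apply₂₁,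
    Matrix.fromBlocks_apply₁₂, Matrix.fromBlocks_apply₂₂, Matrix.zero_apply, mul_zero, Finset.sum_const_zero, add_zero]
  rfl

omit [Fintype α] [DecidableEq α] [Fintype ν] [Fintype μ] [Fintype ρ] [DecidableEq ν] [DecidableEq μ] [DecidableEq ρ] in
/-- [folklore] relabelling a padded slice. -/
theorem fromCols_zero_submatrix (τ : Matrix ρ ν ℝ) (e : ν ≃ ν) (f : μ ≃ μ) (g : ρ ≃ ρ) :
    (fromCols τ (0 : Matrix ρ μ ℝ)).submatrix g (e.sumCongr f) = fromCols (τ.submatrix g e) (0 : Matrix ρ μ ℝ) := by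
  ext i (j | j) <;> rfl

omit [Fintype α] [Fintype ρ] [DecidableEq α] [DecidableEq ρ] [Fintype ν] [Fintype μ] [DecidableEq ν] [DecidableEq μ] in
/-- [folklore] a parity-odd corner insertion is parity-odd. -/
theorem fromBlocks_corner_submatrix_of_odd (R : Matrix ν ν ℝ) (e : ν ≃ ν) (f : μ ≃ μ) (hR : R.submatrix e e = -R) :
    (fromBlocks R 0 0 (0 : Matrix μ μ ℝ)).submatrix (e.sumCongr f) (e.sumCongr f) = -fromBlocks R 0 0 (0 : Matrix μ μ ℝ) := by
  ext (i | i) (j | j)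
  · exact congrFun (congrFun hR i) j
  all_goals simp

/-- [folklore] **(TN) FOR THE ROAD's FINE SLICED SYSTEMS `kkt K [Q; τ]`.**  Form `K` and averaging `Q` reflection-COVARIANT (`K∘(e,e) = K`, `Q∘(f,e) = Q`), both
killing the gauge modes `W` (`K·W = Kᵀ·W = 0`, `Q·W = 0`), remainder `R` PARITY-ODD and BI-TRANSVERSAL, the slice `τ` and its reflection `τ∘(g,e)` admissible
(`τ·W`, `τ∘(g,e)·W` and `kkt K [Q;τ]` invertible): then `tr(flucCov K [Q; τ] · R) = 0` — for the comb slice as it is. -/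
theorem trace_flucCov_fromRows_mul_eq_zero_of_odd (K : Matrix ν ν ℝ) (Q : Matrix μ ν ℝ) (τ : Matrix ρ ν ℝ) (W : Matrix ν ρ ℝ) (R : Matrix ν ν ℝ)
    (e : ν ≃ ν) (f : μ ≃ μ) (g : ρ ≃ ρ) (hK : K.submatrix e e = K) (hQ : Q.submatrix f e = Q) (hR : R.submatrix e e = -R)
    (hKW : K * W = 0) (hKtW : Kᵀ * W = 0) (hQW : Q * W = 0) (hS : IsUnit (τ * W).det) (hSσ : IsUnit (τ.submatrix g e * W).det)
    (h : IsUnit (kkt K (fromRows Q τ)).det) (hRW : R * W = 0) (hWR : Wᵀ * R = 0) :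
    (flucCov K (fromRows Q τ) * R).trace = 0 := by
  rw [flucCov_fromRows_eq, ← trace_mul_fromBlocks_corner]
  refine trace_flucCov_mul_eq_zero_of_odd (kkt K Q) (fromCols τ (0 : Matrix ρ μ ℝ)) (fromRows W (0 : Matrix μ ρ ℝ))
    (fromBlocks R 0 0 (0 : Matrix μ μ ℝ)) (e.sumCongr f) g ?_ (fromBlocks_corner_submatrix_of_odd R e f hR) ?_ ?_ ?_ ?_ ?_ ?_ ?_
  · rw [← kkt_submatrix, hK, hQ]
  · rw [kkt_mul_fromRows, hKW, hQW, Matrix.fromRows_zero]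
  · rw [kkt_transpose_mul_fromRows, hKtW, hQW, Matrix.fromRows_zero]
  · rwa [fromCols_zero_mul_fromRows_zero]
  · rwa [fromCols_zero_submatrix, fromCols_zero_mul_fromRows_zero]
  · rwa [← reindex_kkt_kkt, Matrix.det_reindex_self] at h
  · rw [Matrix.fromBlocks_mul_fromRows, hRW]; simp
  · rw [Matrix.transpose_fromRows, Matrix.fromCols_mul_fromBlocks, hWR]; simp

end ThreeBlock

/-! ## §5 The chain's SIGNED-TRANSPOSE parity class (an2 W-an2-g39-5): slice-blind, one line -/

section SignedTranspose

variable {ι : Type*} [Fintype ι] [DecidableEq ι]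

/-- [folklore] **SIGNED-TRANSPOSE ODD REMAINDERS ARE TRACE-NULL AGAINST SIGNED-TRANSPOSE EVEN OPERATORS** (the matrix form of the chain's
`tadpole_eq_zero_of_parity`, `trK G = sgnK G`, `trK W = −sgnK W ⇒ tadpole G W = 0`): `S·S = 1`, `Fᵀ = S·F·S`, `Rᵀ = −S·R·S` ⇒ `tr(F·R) = 0` — no slice,
no transversality needed; with an2's located parity class of the (Wd) remainders this discharges (TN-fine)∕(TN-os) in one line each. -/
theorem trace_mul_eq_zero_of_transpose_odd (S F R : Matrix ι ι ℝ) (hS : S * S = 1) (hF : Fᵀ = S * F * S) (hR : Rᵀ = -(S * R * S)) :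
    (F * R).trace = 0 := by
  have h1 : (F * R).trace = -((S * R * S * (S * F * S)).trace) := by
    rw [← Matrix.trace_transpose (F * R), Matrix.transpose_mul, hR, hF, Matrix.neg_mul, Matrix.trace_neg]
  have h2 : (S * R * S * (S * F * S)).trace = (F * R).trace := by
    have e1 : S * R * S * (S * F * S) = S * (R * (S * S) * F * S) := by simp only [Matrix.mul_assoc]
    rw [e1, hS, Matrix.mul_one, Matrix.trace_mul_comm]
    have e2 : R * F * S * S = R * F * (S * S) := by rw [Matrix.mul_assoc]
    rw [e2, hS, Matrix.mul_one, Matrix.trace_mul_comm]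
  linarith

/-- [folklore] the `S = 1` case: a SYMMETRIC operator against an ANTISYMMETRIC remainder has zero trace (`flucCov` on the field indices is symmetric for a
symmetric form; an antisymmetric `ff` remainder is trace-null against it — for every slice). -/
theorem trace_mul_eq_zero_of_symm_of_antisymm (F R : Matrix ι ι ℝ) (hF : Fᵀ = F) (hR : Rᵀ = -R) : (F * R).trace = 0 :=
  trace_mul_eq_zero_of_transpose_odd 1 F R (Matrix.mul_one 1) (by rw [Matrix.one_mul, Matrix.mul_one, hF])
    (by rw [Matrix.one_mul, Matrix.mul_one, hR])

end SignedTranspose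

end Summit.QuantumFields.BalabanUV.Beta.FP.SlicedTraceParity

end
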